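import Summits.QuantumFields.YangMills.Theorems.BalabanUVNodesN06L3131HLegAtPinsPhysPU
import Summits.QuantumFields.YangMills.Theorems.BalabanUVNodesN06WELegAtPinsPhysPUB
import Literature.MathematicalPhysics.QuantumFieldTheory.Balaban1983to89.B9SmoothHolderClassStateProducers
import Literature.MathematicalPhysics.QuantumFieldTheory.Balaban1983to89.B9SmoothHolderClassStateDominated
import Literature.MathematicalPhysics.QuantumFieldTheory.Balaban1983to89.B9Thm312WholeStepDirRegular
import Literature.MathematicalPhysics.QuantumFieldTheory.Balaban1983to89.B9Thm313WholeDelta2LettersAtStatePrint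
import Literature.MathematicalPhysics.QuantumFieldTheory.Balaban1983to89.B9Thm312WholeStepRegular
import Literature.MathematicalPhysics.QuantumFieldTheory.Balaban1983to89.B9MultiscaleSmoothPartitionYNear

import Literature.MathematicalPhysics.QuantumFieldTheory.Balaban1983to89.B9SmoothHolderClassPClosure
import Literature.MathematicalPhysics.QuantumFieldTheory.Balaban1983to89.B9SmoothHolderClassPReadingsSite
import Literature.MathematicalPhysics.QuantumFieldTheory.Balaban1983to89.B9Thm312WholeStepDirFrom3131
import Literature.MathematicalPhysics.QuantumFieldTheory.Balaban1983to89.B9Thm313WholeHolder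
import Literature.MathematicalPhysics.QuantumFieldTheory.Balaban1983to89.B9LettersHZAtOne
/-!
# N06 [B9] — THE PRODUCERS INTO THE STATE CLASSES AT THE PINS, PART A (U8 STEP 2b): `G₀∇*_U : 𝔠_Y⁽⁰⁾ → 𝔖₁`, `G₀Q* : Z_{len·w} → 𝔖₁`, `G₀Q* : Z_w → 𝔖₂`,
# `G₀D_U : bH13 x U → 𝔖₂` (R-generic, U-variant), from the certificate's DISPLAYED (3.42)∕(3.43) words and pins

T. Bałaban, *Propagators for lattice gauge theories in a background field*, Commun. Math. Phys. **99** (1985) 389–434 [`Balaban1985BackgroundPropagators`, "B9"], Thm 3.3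
p. 399 with (3.42)–(3.43) pp. 397–398, p. 398 (remark after (3.47)), (3.130) p. 421, (3.138) p. 423; [4] = T. Bałaban, *Propagators and renormalization transformations for
lattice gauge theories. II*, Commun. Math. Phys. **96** (1984) 223–250 [`Balaban1984PropagatorsII`], (2.51)–(2.54) pp. 232–233, Lemma 2.1 (2.60)–(2.61) p. 234.

WHY (director-ym №272 (5) ∕ №285, FLAG №8 (U8); dag-n06-l P-U8S).  dag-n06-l's S-leaves (`thm312Printed_completePairMBZS_rates` ∕ `thm313Printed_completePairMBCZcUS`, LOCATED-S1
repaired twins) take a STATE block `hstate2 ∕ hstate1` at `𝔖₂(x,U) := weightNorm (bXH x U) (rwt (geo9Y x) (−1)) _`, `𝔖₁(x,U) := bXH x U` ((P1′) pin `bHZKPG (taxiB U) wX`).  STEP 2a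
(`hStateFacts_of_pinsP_geo9Y`, p713722) gave `G₀D_U : 𝔠_W⁽¹⁾ → 𝔖₂`, the sup readings, κ, ℓ¹-domination; STEP 2b-A₀ (p715107) `G₀ : 𝔠⁽⁰⁾ → 𝔖₂`.  THIS FILE gives four more
producers, each from members the certificate of record ALREADY DISPLAYS (edition 73∕74, `hG0P`, `hZ8`, `hpXQs`, `hwBG`) or derives (STEP 2a), landed ONCE in the graded class by
dag-n06-l g24 `B9SmoothHolderClassPClosure.hasMaj_into_bHZKPG_of_probeFamily` (sup member + ∀s probe family + `w s·C_b(s) ≤ C_b₀`):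
* `G₀∇*_U : cNormR blkY 0 → 𝔖₁` from `hG0P`'s (3.42)₃ word `he2` (`B₀G·len`) and (3.43)₂ probe family `h43RG` (`BhG s′·len^{1−s′}`), weights `hwBhG : wX s·BhG s ≤ BHG`;
* `G₀Q* : weightNorm (ofBlocks blkZ) (len·wZ) → 𝔖₁` from `hZ8`'s sup word `hgQs1` (`→ 𝔠⁽¹⁾`) and the displayed probe family `hpXQs` (`Bx13 β`), weights `hwBx13 : wX s·Bx13 s ≤ Bx13₀`;
* `G₀Q* : weightNorm (ofBlocks blkZ) wZ → 𝔖₂` — the previous one rescaled by one power of `Lʲη` ([4] (2.60), `hasMaj_rescale (γ := −1)`: factor `L`, rate `−τ`);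
* `G₀D_U : bH13 x U → 𝔖₂` — STEP 2a's `G₀D_U : 𝔠_W⁽¹⁾ → 𝔖₂` (input `hGDW`) precomposed with the SUP READING `id : bH13 x U → 𝔠_W⁽¹⁾` of the (P2′) site pin
  (`B9SmoothHolderClassPReadingsSite.hasMaj_id_bHZPG_cNorm`; only `|λ|` of `‖λ‖ + |λ|` is read) — the `hGD` input of `stepS_of_lettersS`.
All at one common rate `δ_P` (`hδP₀ : δ_P + τ ≤ δ₀G`, `hδP₃ : δ_P + τ ≤ δ12₃`, `hδPW : δ_P + σ ≤ δ_W`) and closed constants `A_D A_Q1 A_Q A_W′` (`hAD hAQ1 hAQ hAW`).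
HONEST LABEL: helper toward the U8 re-leaf; every member enters as a HYPOTHESIS of printed species ((3.42)∕(3.43) for G₀) or is a landed pin fact; count-neutral; N06 NOT
discharged; K1⁹ NOT closed; nothing continuum ∕ OS ∕ mass gap ∕ Clay.  Cell `pub-ymgap` (HUMAN RULING D-0062), Track A node N06 [B9], seat `pub-ymgap-dag-n06-d` (g18), 2026-08-29.
NEW file; nothing landed is modified.
-/

noncomputable section

namespace Summit.QuantumFields.YangMills.BalabanUVNodes.N06StateProducersAAtPinsPU

open Literature.MathematicalPhysics.QuantumFieldTheory.Balaban1983to89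
open Literature.MathematicalPhysics.QuantumFieldTheory.Balaban1983to89.Node00 (FBondY IBondY SiteY CfgY SiteParY SiteOpY parSymY GpY GpPhysY BondOpY toKT)
open Literature.MathematicalPhysics.QuantumFieldTheory.Balaban1983to89.Node00.OpsYSectDCoords (DvcoKH DvscoKH TpicoK T2coK cR39_trBasis_pos)
open B9Thm39ReadingCoords (cR39)
open B9Thm34Ext (toB6)
open B11SectG (HasMaj BlockNorm RowSum)
open B9Thm312Whole (cNorm GeoOK)
open B9Thm312WholeClasses (cNormR rwt rwt_nonneg)
open B9RWSums343to347Whole (Facts347)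
open B9CoReadingCoords (XBK blkBK)
open B9CoReadingCoordsS (XSK sIK blkSK GcoS)
open B9CoReadingCoordsH (XHK)
open B9CoReadingCoordsTranspose (TrIdx trBasis)
open B9PinMembersKLevelV1 (MemberY geo9Y)
open B9BackgroundsKLevelV1R (RegFamY bg9YR MemOfFam)
open B9GeoLemma21KLevelV1 (geo9Y_len_pos geo9Y_dist_triangle geo9Y_dist_comm rowSum261_geo9Y)
open B9GeoNormsKLevelV1 (geo9K geo9K_dist_nonneg)
open B7Prop2SpecialUnitary (specialUnitaryUnits)
open B9PerturbationMajorantAlgebra (Proj349Maj Thm31GpMaj hasMaj_weaken)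
open B9PerturbationMajorantsAtLetters (PcoK)
open B9MultiscaleSmoothPartitionYNear (rNear dist_sIK_le_of_nearY)
open B9SmoothHolderClassP (bHZKP bHZKPG bHZPG)
open B9GradViaDivLettersTransported (taxiB taxiS)
open B9PerturbationSplitAtLetters (TaLcoK TbLcoKH Ta2LcoK Tb2LcoKH tpi_t2_splitL_of_pins)
open B9PerturbationL2Delta2 (D2coK)
open B9SmoothHolderClassPProducers (CTel CTel_nonneg CTel_mono CTel_mul)
open B9SmoothHolderClassTClosure (abs_cf_eq_nKT)
open B9RWSums347DefiniteFaces (geo9Y_scalars exp261 facts347_exp261_geo9Y)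
open B9RowSum261DefiniteFaces (rowConst261 rowConst261_nonneg rowConst261_spec_of_rowSum261)
open B9SectDSup (weightNorm)
open B6RandomWalk (HasMajorant)
open B9Thm312WholeStepRegular (LettersS3131)
open B9Thm313WholeDelta2LettersAtStatePrint (ta2S_pins_print_of_h44G tb₂HS_pins_print_of_h43 hasMaj_state_of_raw_two)
open Summit.QuantumFields.YangMills.BalabanUVNodes.N06HolderPinsGradedAtRecord (links_le_one)
open B6Prop22KLevelTorusCensusEta (nKT)
open B6GlobalChartV1 (PV blkV1) open B6Ineq2142KLevelV1 (β lvl) open B6Geom246MultiLevelTorus (geomT)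
open scoped Matrix.Norms.L2Operator

open B9SmoothHolderClassState (hasMaj_id_state)
open B9SmoothHolderClassStateProducers (hasMaj_into_state_of_sup_probes)
open B9SmoothHolderClassStateDominated (exists_state_loc_le_sum)
open B9Thm312WholeStepDirRegular (readS_up)
open B9SectDSup (weightNorm_κ weightNorm_loc)
open B9CoReadingCoordsHolder (PK blkPK probeK wK w₀K)
open B9CoReadingCoordsHolderAdm (wKA holderProbesKA)
open B9RWSums343Holder (HolderProbes)
open B9MultiscaleSmoothPartitionYLip (CLip)
open Summit.QuantumFields.YangMills.BalabanUVNodes.N06WELegAtPinsPhysPUB (hκX_of_pinsP)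
open Literature.MathematicalPhysics.QuantumFieldTheory.Balaban1983to89.Node00 (parBY BondParY)

open B9SmoothHolderClassPClosure (hasMaj_into_bHZKPG_of_probeFamily)
open B9SmoothHolderClassPReadingsSite (hasMaj_id_bHZPG_cNorm)
open B9Thm312WholeClasses (hasMaj_cNormR_of_hasMajorantHom)
open B9Thm312WholeStepDirFrom3131 (hasMaj_probe_cNormR_of_hom)
open B9Thm313WholeHolder (hasMaj_toR_tgt)
open B9SmoothHolderClassState (hasMaj_rescale hasMaj_congr_src)
open B9LettersHZAtOne (plateau_pos)
open B11SectG (hasMaj_comp_exp)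
open B9Thm312Whole (cNorm_κ)
open B6RandomWalkHom (HasMajorantHom hasMajorantHom_mono)
open B9CoReadingCoordsH (blkHK)

variable {N : ℕ} {d ℓ : ℕ} {hd : 1 ≤ d + 1} {hL : Odd (ℓ + 1) ∧ 1 < ℓ + 1} {b₀ b₁ : ℝ} {Mstar : ℕ}

/-- ★★★ **FOUR PRODUCERS INTO THE STATE CLASSES AT THE PINS** (module docstring), member-uniformly in `x`, for `M ≥ M_T`, `Mα₀ ≤ a₀`, U ∈ (3.35)–(3.36).
[cite: Balaban1985BackgroundPropagators, Thm 3.3 p.399, (3.42)–(3.43) pp.397–398, p.398 (remark after (3.47)), (3.130) p.421, (3.138) p.423;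
Balaban1984PropagatorsII, (2.51)–(2.54) pp.232–233, Lemma 2.1 (2.60)–(2.61) p.234] -/
theorem hProducersA_of_pinsP_geo9Y [NeZero N] [∀ x : MemberY d ℓ hd hL b₀ b₁ Mstar, Fintype (geo9Y x).Site]
    {R₁ R₂ : RegFamY d ℓ hd hL b₀ b₁ Mstar (Matrix (Fin N) (Fin N) ℂ)} (H : MemberY d ℓ hd hL b₀ b₁ Mstar → Prop)
    (bI : ∀ x : MemberY d ℓ hd hL b₀ b₁ Mstar, FBondY x.toKIdx → IBondY x.toKIdx)
    (hlev : ∀ (x : MemberY d ℓ hd hL b₀ b₁ Mstar) (f : FBondY x.toKIdx), lvl x.hN x.D x.hk (bI x f) = (blkV1 x.hN x.D f).1.1)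
    (hβ1 : ∀ (x : MemberY d ℓ hd hL b₀ b₁ Mstar) (f : FBondY x.toKIdx), (geomT x.D).dist (β x.hN x.D x.hk (bI x f)) (blkV1 x.hN x.D f) ≤ 1)
    (hbI0 : ∀ (x : MemberY d ℓ hd hL b₀ b₁ Mstar) (f : FBondY x.toKIdx), bI x f = bI x ⟨f.src, 0⟩)
    (c : ℝ) {M₀ a₀ : ℝ} {σ τ : ℝ} (hσ : 0 < σ) (hτ : 0 < τ)
    (w13 : ℝ → ℝ) (hw13₀ : ∀ s, 0 ≤ w13 s) (hw13₁ : ∀ s, w13 s ≤ 1)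
    (bH13 : ∀ x : MemberY d ℓ hd hL b₀ b₁ Mstar, (bg9YR (Matrix (Fin N) (Fin N) ℂ) (specialUnitaryUnits (Fin N)) R₁ R₂ x).Cfg → BlockNorm (toB6 (geo9Y x) 1 (H x)) (XSK (TrIdx N) x.toKIdx → ℝ))
    (hbH13 : ∀ (x : MemberY d ℓ hd hL b₀ b₁ Mstar) (U : (bg9YR (Matrix (Fin N) (Fin N) ℂ) (specialUnitaryUnits (Fin N)) R₁ R₂ x).Cfg), bH13 x U =
      letI : Fintype (geo9K x.toKIdx).Site := (inferInstance : Fintype (geo9Y x).Site);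
      bHZPG (κ := TrIdx N) x.toKIdx (trBasis N) (taxiS x.toKIdx (bg9YR (Matrix (Fin N) (Fin N) ℂ) (specialUnitaryUnits (Fin N)) R₁ R₂ x) (fun U => U) U) (R := (1 : ℝ)) (H := H x) w13 hw13₀ hw13₁)
    (wX : ℝ → ℝ) (hwX₀ : ∀ s, 0 ≤ wX s) (hwX₁ : ∀ s, wX s ≤ 1)
    (bXH : ∀ x : MemberY d ℓ hd hL b₀ b₁ Mstar, (bg9YR (Matrix (Fin N) (Fin N) ℂ) (specialUnitaryUnits (Fin N)) R₁ R₂ x).Cfg → BlockNorm (toB6 (geo9Y x) 1 (H x)) (XBK (TrIdx N) x.toKIdx → ℝ))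
    (hbXH : ∀ (x : MemberY d ℓ hd hL b₀ b₁ Mstar) (U : (bg9YR (Matrix (Fin N) (Fin N) ℂ) (specialUnitaryUnits (Fin N)) R₁ R₂ x).Cfg), bXH x U =
      letI : Fintype (geo9K x.toKIdx).Site := (inferInstance : Fintype (geo9Y x).Site);
      bHZKPG (κ := TrIdx N) x.toKIdx (trBasis N) (taxiB x.toKIdx (bg9YR (Matrix (Fin N) (Fin N) ℂ) (specialUnitaryUnits (Fin N)) R₁ R₂ x) (fun U => U) U) (R := (1 : ℝ)) (H := H x) wX hwX₀ hwX₁)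
    {s44 : ℝ} (hs440 : 0 < s44) (hs441 : s44 < 1) (hw1344 : 0 < w13 s44)
    (𝔬12 : ∀ x : MemberY d ℓ hd hL b₀ b₁ Mstar, B9Thm312Whole.Ops (geo9Y x) (bg9YR (Matrix (Fin N) (Fin N) ℂ) (specialUnitaryUnits (Fin N)) R₁ R₂ x) (XBK (TrIdx N) x.toKIdx) (XBK (TrIdx N) x.toKIdx) (XHK (TrIdx N) x.toKIdx) (XSK (TrIdx N) x.toKIdx))
    (hblk12 : ∀ x : MemberY d ℓ hd hL b₀ b₁ Mstar, (𝔬12 x).blk = blkBK x.toKIdx (bI x))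
    (hblkW12 : ∀ x : MemberY d ℓ hd hL b₀ b₁ Mstar, (𝔬12 x).blkW = blkSK x.toKIdx (sIK x.toKIdx (bI x)))
    (𝔭A : ∀ x : MemberY d ℓ hd hL b₀ b₁ Mstar, HolderProbes (geo9Y x) (bg9YR (Matrix (Fin N) (Fin N) ℂ) (specialUnitaryUnits (Fin N)) R₁ R₂ x) (XBK (TrIdx N) x.toKIdx) (XBK (TrIdx N) x.toKIdx) (PK (FBondY x.toKIdx) (Fin (d + 1)) (TrIdx N)) (PK (FBondY x.toKIdx) (Fin (d + 1)) (TrIdx N)))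
    {parB : ∀ x : MemberY d ℓ hd hL b₀ b₁ Mstar, BondParY (Matrix (Fin N) (Fin N) ℂ) x.toKIdx} (hparB : ∀ x : MemberY d ℓ hd hL b₀ b₁ Mstar, parB x = parBY x.toKIdx)
    (h𝔭A : ∀ x : MemberY d ℓ hd hL b₀ b₁ Mstar, 𝔭A x = holderProbesKA x.toKIdx (trBasis N) (bg9YR (Matrix (Fin N) (Fin N) ℂ) (specialUnitaryUnits (Fin N)) R₁ R₂ x) (fun U => U) (parB x) (bI x))
    -- numerics: the displayed constants of the four words, the weights' graded bounds, the common rate and the closed output constants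
    {B₀G δ₀G BHG B12₃ δ12₃ Bx13₀ AW δW δP AD AQ1 AQ AW' : ℝ} {BhG Bx13 : ℝ → ℝ}
    (hB₀G : 0 ≤ B₀G) (hBhG : ∀ s, 0 < s → s < 1 → 0 ≤ BhG s) (hBHG : 0 ≤ BHG) (hwBhG : ∀ s, 0 < s → s < 1 → wX s * BhG s ≤ BHG)
    (hB12₃ : 0 ≤ B12₃) (hBx13 : ∀ β, 0 ≤ β → β < 1 → 0 ≤ Bx13 β) (hBx13₀ : 0 ≤ Bx13₀) (hwBx13 : ∀ s, 0 < s → s < 1 → wX s * Bx13 s ≤ Bx13₀)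
    (hAW0 : 0 ≤ AW) (hδP : 0 ≤ δP) (hδP₀ : δP + τ ≤ δ₀G) (hδP₃ : δP + τ ≤ δ12₃) (hδPW : δP + σ ≤ δW)
    (hAD : (((ℓ + 1 : ℕ) : ℝ)) * (B₀G + BHG) * Real.exp (δ₀G * (rNear d ℓ + 1)) ≤ AD)
    (hAQ1 : (((ℓ + 1 : ℕ) : ℝ)) * (B12₃ + Bx13₀) * Real.exp (δ12₃ * (rNear d ℓ + 1)) ≤ AQ1)
    (hAQ : (((ℓ + 1 : ℕ) : ℝ)) * (B12₃ + Bx13₀) * Real.exp (δ12₃ * (rNear d ℓ + 1)) * (((ℓ + 1 : ℕ) : ℝ)) ≤ AQ)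
    (hAW : AW * ((w13 s44)⁻¹ * ((((ℓ + 1 : ℕ) : ℝ)) * Real.exp ((δP + σ) * (rNear d ℓ + 1)))) * rowConst261 (@geo9Y d ℓ hd hL b₀ b₁ Mstar) σ ≤ AW')
    -- the displayed words (certificate `hG0P`.2.1 ∕ .2.2.1, `hZ8`.2.2.1, `hpXQs`) and STEP 2a's producer `hGDW`
    (he2 : ∀ x : MemberY d ℓ hd hL b₀ b₁ Mstar, M₀ ≤ (geo9Y x).M → ∀ α₀ : ℝ, 0 < α₀ → (geo9Y x).M * α₀ ≤ a₀ → ∀ U : (bg9YR (Matrix (Fin N) (Fin N) ℂ) (specialUnitaryUnits (Fin N)) R₁ R₂ x).Cfg, (bg9YR (Matrix (Fin N) (Fin N) ℂ) (specialUnitaryUnits (Fin N)) R₁ R₂ x).Reg335 c α₀ U → (bg9YR (Matrix (Fin N) (Fin N) ℂ) (specialUnitaryUnits (Fin N)) R₁ R₂ x).Reg336 c α₀ U →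
      HasMajorantHom (g := toB6 (geo9Y x) 1 (H x)) (𝔬12 x).blkY (𝔬12 x).blk ((𝔬12 x).G0 U ∘ₗ (𝔬12 x).Dstar U) (fun a b => B₀G * (geo9Y x).len a * Real.exp (-(δ₀G * (geo9Y x).dist a b))))
    (h43RG : ∀ x : MemberY d ℓ hd hL b₀ b₁ Mstar, M₀ ≤ (geo9Y x).M → ∀ α₀ : ℝ, 0 < α₀ → (geo9Y x).M * α₀ ≤ a₀ → ∀ U : (bg9YR (Matrix (Fin N) (Fin N) ℂ) (specialUnitaryUnits (Fin N)) R₁ R₂ x).Cfg, (bg9YR (Matrix (Fin N) (Fin N) ℂ) (specialUnitaryUnits (Fin N)) R₁ R₂ x).Reg335 c α₀ U → (bg9YR (Matrix (Fin N) (Fin N) ℂ) (specialUnitaryUnits (Fin N)) R₁ R₂ x).Reg336 c α₀ U →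
      ∀ s' : ℝ, 0 < s' → s' < 1 → HasMajorantHom (g := toB6 (geo9Y x) 1 (H x)) (𝔬12 x).blkY (𝔭A x).blkPX ((𝔭A x).ΦX U s' ∘ₗ ((𝔬12 x).G0 U ∘ₗ (𝔬12 x).Dstar U)) (fun (a b : (geo9Y x).Site) => BhG s' * (geo9Y x).len a ^ (1 - s') * Real.exp (-(δ₀G * (geo9Y x).dist a b))))
    (hgQs1 : ∀ x : MemberY d ℓ hd hL b₀ b₁ Mstar, M₀ ≤ (geo9Y x).M → ∀ α₀ : ℝ, 0 < α₀ → (geo9Y x).M * α₀ ≤ a₀ → ∀ U : (bg9YR (Matrix (Fin N) (Fin N) ℂ) (specialUnitaryUnits (Fin N)) R₁ R₂ x).Cfg, (bg9YR (Matrix (Fin N) (Fin N) ℂ) (specialUnitaryUnits (Fin N)) R₁ R₂ x).Reg335 c α₀ U → (bg9YR (Matrix (Fin N) (Fin N) ℂ) (specialUnitaryUnits (Fin N)) R₁ R₂ x).Reg336 c α₀ U →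
      HasMaj (weightNorm (BlockNorm.ofBlocks (toB6 (geo9Y x) 1 (H x)) (𝔬12 x).blkZ) (fun y => (geo9Y x).len y * (fun y => ((((ℓ + 1 : ℕ) : ℝ) ^ (d + 1)) ^ lvl x.hN x.D x.hk y)⁻¹) y) (fun y => (mul_pos (geo9Y_len_pos x y) (plateau_pos x.toKIdx y)).le)) (cNorm 1 (H x) (𝔬12 x).blk (fun y => (geo9Y_len_pos x y).le) 1) ((𝔬12 x).G0 U ∘ₗ (𝔬12 x).Qstar U) (fun a b => B12₃ * Real.exp (-(δ12₃ * (geo9Y x).dist a b))))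
    (hpXQs : ∀ x : MemberY d ℓ hd hL b₀ b₁ Mstar, M₀ ≤ (geo9Y x).M → ∀ α₀ : ℝ, 0 < α₀ → (geo9Y x).M * α₀ ≤ a₀ → ∀ U : (bg9YR (Matrix (Fin N) (Fin N) ℂ) (specialUnitaryUnits (Fin N)) R₁ R₂ x).Cfg, (bg9YR (Matrix (Fin N) (Fin N) ℂ) (specialUnitaryUnits (Fin N)) R₁ R₂ x).Reg335 c α₀ U → (bg9YR (Matrix (Fin N) (Fin N) ℂ) (specialUnitaryUnits (Fin N)) R₁ R₂ x).Reg336 c α₀ U → ∀ β : ℝ, 0 ≤ β → β < 1 →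
      HasMaj (weightNorm (BlockNorm.ofBlocks (toB6 (geo9Y x) 1 (H x)) (𝔬12 x).blkZ) (fun y => (geo9Y x).len y * (fun y => ((((ℓ + 1 : ℕ) : ℝ) ^ (d + 1)) ^ lvl x.hN x.D x.hk y)⁻¹) y) (fun y => (mul_pos (geo9Y_len_pos x y) (plateau_pos x.toKIdx y)).le)) (cNormR 1 (H x) (𝔭A x).blkPX (fun y => (geo9Y_len_pos x y).le) (β - 1)) (((𝔭A x).ΦX U β ∘ₗ (𝔬12 x).G0 U) ∘ₗ (𝔬12 x).Qstar U) (fun a b => Bx13 β * Real.exp (-(δ12₃ * (geo9Y x).dist a b))))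
    (hGDW : ∀ x : MemberY d ℓ hd hL b₀ b₁ Mstar, M₀ ≤ (geo9Y x).M → ∀ α₀ : ℝ, 0 < α₀ → (geo9Y x).M * α₀ ≤ a₀ → ∀ U : (bg9YR (Matrix (Fin N) (Fin N) ℂ) (specialUnitaryUnits (Fin N)) R₁ R₂ x).Cfg, (bg9YR (Matrix (Fin N) (Fin N) ℂ) (specialUnitaryUnits (Fin N)) R₁ R₂ x).Reg335 c α₀ U → (bg9YR (Matrix (Fin N) (Fin N) ℂ) (specialUnitaryUnits (Fin N)) R₁ R₂ x).Reg336 c α₀ U →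
      HasMaj (cNorm 1 (H x) (𝔬12 x).blkW (fun y => (geo9Y_len_pos x y).le) 1) (weightNorm (bXH x U) (rwt (geo9Y x) (-1)) (rwt_nonneg (fun y => (geo9Y_len_pos x y).le) (-1))) ((𝔬12 x).G0 U ∘ₗ (𝔬12 x).Dv U)
        (fun a b => AW * Real.exp (-(δW * (geo9Y x).dist a b)))) :
    ∃ MT : ℝ, ∀ x : MemberY d ℓ hd hL b₀ b₁ Mstar, MT ≤ (geo9Y x).M → ∀ α₀ : ℝ, 0 < α₀ → (geo9Y x).M * α₀ ≤ a₀ → ∀ U : (bg9YR (Matrix (Fin N) (Fin N) ℂ) (specialUnitaryUnits (Fin N)) R₁ R₂ x).Cfg, (bg9YR (Matrix (Fin N) (Fin N) ℂ) (specialUnitaryUnits (Fin N)) R₁ R₂ x).Reg335 c α₀ U → (bg9YR (Matrix (Fin N) (Fin N) ℂ) (specialUnitaryUnits (Fin N)) R₁ R₂ x).Reg336 c α₀ U →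
      HasMaj (cNormR 1 (H x) (𝔬12 x).blkY (fun y => (geo9Y_len_pos x y).le) 0) (bXH x U) ((𝔬12 x).G0 U ∘ₗ (𝔬12 x).Dstar U)
          (fun a b => AD * Real.exp (-(δP * (geo9Y x).dist a b))) ∧
        HasMaj (weightNorm (BlockNorm.ofBlocks (toB6 (geo9Y x) 1 (H x)) (𝔬12 x).blkZ) (fun y => (geo9Y x).len y * (fun y => ((((ℓ + 1 : ℕ) : ℝ) ^ (d + 1)) ^ lvl x.hN x.D x.hk y)⁻¹) y) (fun y => (mul_pos (geo9Y_len_pos x y) (plateau_pos x.toKIdx y)).le)) (bXH x U)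
          ((𝔬12 x).G0 U ∘ₗ (𝔬12 x).Qstar U) (fun a b => AQ1 * Real.exp (-(δP * (geo9Y x).dist a b))) ∧
        HasMaj (weightNorm (BlockNorm.ofBlocks (toB6 (geo9Y x) 1 (H x)) (𝔬12 x).blkZ) (fun y => ((((ℓ + 1 : ℕ) : ℝ) ^ (d + 1)) ^ lvl x.hN x.D x.hk y)⁻¹) (fun y => (plateau_pos x.toKIdx y).le))
          (weightNorm (bXH x U) (rwt (geo9Y x) (-1)) (rwt_nonneg (fun y => (geo9Y_len_pos x y).le) (-1))) ((𝔬12 x).G0 U ∘ₗ (𝔬12 x).Qstar U)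
          (fun a b => AQ * Real.exp (-(δP * (geo9Y x).dist a b))) ∧
        HasMaj (bH13 x U) (weightNorm (bXH x U) (rwt (geo9Y x) (-1)) (rwt_nonneg (fun y => (geo9Y_len_pos x y).le) (-1))) ((𝔬12 x).G0 U ∘ₗ (𝔬12 x).Dv U)
          (fun a b => AW' * Real.exp (-(δP * (geo9Y x).dist a b))) := by
  obtain ⟨Mg, hFa⟩ := facts347_exp261_geo9Y (d := d) (ℓ := ℓ) (hd := hd) (hL := hL) (b₀ := b₀) (b₁ := b₁) (Mstar := Mstar) H (α := 1 / 2) (δ := 2 * τ)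
    (by norm_num) (by norm_num) (by linarith)
  obtain ⟨ML, hrow⟩ := rowConst261_spec_of_rowSum261 (rowSum261_geo9Y (d := d) (ℓ := ℓ) (hd := hd) (hL := hL) (b₀ := b₀) (b₁ := b₁) (Mstar := Mstar)) hσ
  have hc0 : (0 : ℝ) ≤ rowConst261 (@geo9Y d ℓ hd hL b₀ b₁ Mstar) σ := rowConst261_nonneg _ _
  have hτe : (1 : ℝ) / 2 * (2 * τ) = τ := by ring
  refine ⟨max M₀ (max Mg ML), fun x hM α₀ hα ha U hU hU' => ?_⟩
  letI : Fintype (geo9K x.toKIdx).Site := (inferInstance : Fintype (geo9Y x).Site)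
  have hM0 : M₀ ≤ (geo9Y x).M := (le_max_left _ _).trans hM
  have hFax := hFa x (((le_max_left _ _).trans (le_max_right _ _)).trans hM)
  have hrowx : RowSum (toB6 (geo9Y x) 1 (H x)) σ (rowConst261 (@geo9Y d ℓ hd hL b₀ b₁ Mstar) σ) := fun y => hrow x (((le_max_right _ _).trans (le_max_right _ _)).trans hM) y
  have hG : GeoOK (geo9Y x) := ⟨geo9Y_dist_triangle x, geo9Y_dist_comm x, geo9K_dist_nonneg x.toKIdx, geo9Y_len_pos x⟩
  have htri : B6RandomWalk.Triangle254 (toB6 (geo9Y x) 1 (H x)) := fun a b e => hG.tri a b e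
  have hcf := abs_cf_eq_nKT x.toKIdx x.hcfk
  have hNr : ∀ (y : IBondY x.toKIdx) (z : SiteY x.toKIdx), B9MultiscaleSmoothPartitionY.NearY x.toKIdx y z → (geo9K x.toKIdx).dist y (sIK x.toKIdx (bI x) z) ≤ rNear d ℓ + 1 :=
    fun y z h => dist_sIK_le_of_nearY x.toKIdx (hβ1 x) h
  have hLx : (geo9Y x).L ≤ (((ℓ + 1 : ℕ) : ℝ)) := (geo9Y_scalars x).2.1
  have hLxK : (geo9K x.toKIdx).L ≤ (((ℓ + 1 : ℕ) : ℝ)) := hLx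
  have hL0K : 0 ≤ (geo9K x.toKIdx).L := le_trans zero_le_one hFax.one_le_L
  have hL1 : (1 : ℝ) ≤ ((ℓ + 1 : ℕ) : ℝ) := by exact_mod_cast Nat.succ_le_succ (Nat.zero_le ℓ)
  have hδ₀G0 : 0 ≤ δ₀G := by linarith
  have hδ12₃0 : 0 ≤ δ12₃ := by linarith
  -- (1) G₀∇*_U INTO 𝔖₁ = bXH x U: (3.42)₃ sup word + (3.43)₂ probe family, landed once (g24)
  have hsupD : HasMaj (cNormR 1 (H x) (𝔬12 x).blkY hG.lenle 0) (cNormR 1 (H x) (blkBK x.toKIdx (bI x)) hG.lenle (-1)) ((𝔬12 x).G0 U ∘ₗ (𝔬12 x).Dstar U)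
      (fun a b => B₀G * Real.exp (-(δ₀G * (geo9Y x).dist a b))) := by
    have h := hasMaj_cNormR_of_hasMajorantHom hG (C := fun a b => B₀G * Real.exp (-(δ₀G * (geo9Y x).dist a b)))
      (fun a b => mul_nonneg hB₀G (Real.exp_nonneg _)) 1 0
      (hasMajorantHom_mono (g := toB6 (geo9Y x) 1 (H x)) _ _ (he2 x hM0 α₀ hα ha U hU hU') fun a b =>
        le_of_eq (by simp only [Real.rpow_zero, Real.rpow_one, mul_one]; ring))
    rw [hblk12 x] at h
    exact h
  have hprD : ∀ s : ℝ, 0 < s → s < 1 → HasMaj (cNormR 1 (H x) (𝔬12 x).blkY hG.lenle 0) (cNormR 1 (H x) (blkPK (bI x)) hG.lenle (s - 1))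
      (probeK (trBasis N) (taxiB x.toKIdx (bg9YR (Matrix (Fin N) (Fin N) ℂ) (specialUnitaryUnits (Fin N)) R₁ R₂ x) (fun U => U) U) (wKA x.toKIdx s) (w₀K x.toKIdx s) ∘ₗ ((𝔬12 x).G0 U ∘ₗ (𝔬12 x).Dstar U))
      (fun a b => BhG s * Real.exp (-(δ₀G * (geo9K x.toKIdx).dist a b))) := by
    intro s hs0 hs1
    have h := hasMaj_probe_cNormR_of_hom hG (hBhG s hs0 hs1) (h43RG x hM0 α₀ hα ha U hU hU' s hs0 hs1)
    rw [h𝔭A x, hparB x] at h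
    exact h
  have hPD := hasMaj_into_bHZKPG_of_probeFamily x.toKIdx (trBasis N) (taxiB x.toKIdx (bg9YR (Matrix (Fin N) (Fin N) ℂ) (specialUnitaryUnits (Fin N)) R₁ R₂ x) (fun U => U) U)
    hG.lenle wX hwX₀ hwX₁ (hβ1 x) (hlev x) (hbI0 x) hδ₀G0 hcf hB₀G hBHG hBhG hwBhG hsupD hprD
  rw [← hbXH x U] at hPD
  -- (2) G₀Q* INTO 𝔖₁ out of `Z_{len·w}`: the displayed sup word + probe family
  have hsupQ : HasMaj (weightNorm (BlockNorm.ofBlocks (toB6 (geo9Y x) 1 (H x)) (𝔬12 x).blkZ) (fun y => (geo9Y x).len y * (fun y => ((((ℓ + 1 : ℕ) : ℝ) ^ (d + 1)) ^ lvl x.hN x.D x.hk y)⁻¹) y) (fun y => (mul_pos (geo9Y_len_pos x y) (plateau_pos x.toKIdx y)).le))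
      (cNormR 1 (H x) (blkBK x.toKIdx (bI x)) hG.lenle (-1)) ((𝔬12 x).G0 U ∘ₗ (𝔬12 x).Qstar U) (fun a b => B12₃ * Real.exp (-(δ12₃ * (geo9Y x).dist a b))) := by
    have h := hasMaj_toR_tgt hG (hgQs1 x hM0 α₀ hα ha U hU hU')
    rw [Nat.cast_one, hblk12 x] at h
    exact h
  have hprQ : ∀ s : ℝ, 0 < s → s < 1 → HasMaj (weightNorm (BlockNorm.ofBlocks (toB6 (geo9Y x) 1 (H x)) (𝔬12 x).blkZ) (fun y => (geo9Y x).len y * (fun y => ((((ℓ + 1 : ℕ) : ℝ) ^ (d + 1)) ^ lvl x.hN x.D x.hk y)⁻¹) y) (fun y => (mul_pos (geo9Y_len_pos x y) (plateau_pos x.toKIdx y)).le))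
      (cNormR 1 (H x) (blkPK (bI x)) hG.lenle (s - 1))
      (probeK (trBasis N) (taxiB x.toKIdx (bg9YR (Matrix (Fin N) (Fin N) ℂ) (specialUnitaryUnits (Fin N)) R₁ R₂ x) (fun U => U) U) (wKA x.toKIdx s) (w₀K x.toKIdx s) ∘ₗ ((𝔬12 x).G0 U ∘ₗ (𝔬12 x).Qstar U))
      (fun a b => Bx13 s * Real.exp (-(δ12₃ * (geo9K x.toKIdx).dist a b))) := by
    intro s hs0 hs1
    have h := hpXQs x hM0 α₀ hα ha U hU hU' s hs0.le hs1
    rw [h𝔭A x, hparB x] at h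
    exact h.congr fun μ => rfl
  have hPQ := hasMaj_into_bHZKPG_of_probeFamily x.toKIdx (trBasis N) (taxiB x.toKIdx (bg9YR (Matrix (Fin N) (Fin N) ℂ) (specialUnitaryUnits (Fin N)) R₁ R₂ x) (fun U => U) U)
    hG.lenle wX hwX₀ hwX₁ (hβ1 x) (hlev x) (hbI0 x) hδ12₃0 hcf hB12₃ hBx13₀ (fun s hs0 hs1 => hBx13 s hs0.le hs1) hwBx13 hsupQ hprQ
  rw [← hbXH x U] at hPQ
  -- (3) G₀Q* INTO 𝔖₂ out of `Z_w`: one power of `Lʲη` moved from the source weight to the target weight ([4] (2.60))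
  have hK0 : 0 ≤ ((ℓ + 1 : ℕ) : ℝ) * (B12₃ + Bx13₀) * Real.exp (δ12₃ * (rNear d ℓ + 1)) := by positivity
  have hPQ2' := hasMaj_rescale hG hFax (-1 : ℝ) (by norm_num) hK0 hPQ
  rw [show |(-1 : ℝ)| = 1 by norm_num, Real.rpow_one, hτe] at hPQ2'
  have hPQ2 : HasMaj (weightNorm (BlockNorm.ofBlocks (toB6 (geo9Y x) 1 (H x)) (𝔬12 x).blkZ) (fun y => ((((ℓ + 1 : ℕ) : ℝ) ^ (d + 1)) ^ lvl x.hN x.D x.hk y)⁻¹) (fun y => (plateau_pos x.toKIdx y).le))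
      (weightNorm (bXH x U) (rwt (geo9Y x) (-1)) (rwt_nonneg (fun y => (geo9Y_len_pos x y).le) (-1))) ((𝔬12 x).G0 U ∘ₗ (𝔬12 x).Qstar U)
      (fun a b => ((ℓ + 1 : ℕ) : ℝ) * (B12₃ + Bx13₀) * Real.exp (δ12₃ * (rNear d ℓ + 1)) * (geo9Y x).L * Real.exp (-((δ12₃ - τ) * (geo9Y x).dist a b))) := by
    refine hasMaj_congr_src (fun y f => ?_) (fun _ _ hl => by exact hl) hPQ2'
    simp only [weightNorm_loc, rwt, Real.rpow_neg_one]
    rw [← mul_assoc, ← mul_assoc, inv_mul_cancel₀ (geo9Y_len_pos x y).ne', one_mul]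
  -- (4) G₀D_U INTO 𝔖₂ out of bH13: STEP 2a's W-sup producer after the sup reading of the (P2′) site pin
  have hid : HasMaj (bH13 x U) (cNorm 1 (H x) (𝔬12 x).blkW hG.lenle 1) LinearMap.id
      (fun a b => (w13 s44)⁻¹ * ((((ℓ + 1 : ℕ) : ℝ)) * Real.exp ((δP + σ) * (rNear d ℓ + 1)) * Real.exp (-((δP + σ) * (geo9Y x).dist a b)))) := by
    rw [hbH13 x U, hblkW12 x]
    exact hasMaj_id_bHZPG_cNorm x.toKIdx (trBasis N) (taxiS x.toKIdx (bg9YR (Matrix (Fin N) (Fin N) ℂ) (specialUnitaryUnits (Fin N)) R₁ R₂ x) (fun U => U) U) w13 hw13₀ hw13₁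
      hs440 hs441 hw1344 hG.lenle (hlev x) (by linarith) hNr hcf
  have hid' : HasMaj (bH13 x U) (cNorm 1 (H x) (𝔬12 x).blkW hG.lenle 1) LinearMap.id
      (fun a b => (w13 s44)⁻¹ * ((((ℓ + 1 : ℕ) : ℝ)) * Real.exp ((δP + σ) * (rNear d ℓ + 1))) * Real.exp (-((δP + σ) * (geo9Y x).dist a b))) :=
    hid.mono fun a b => le_of_eq (by ring)
  have hGD := hasMaj_comp_exp htri hG.dnn hrowx hAW0 (by positivity) hδP (by linarith) hδPW (hGDW x hM0 α₀ hα ha U hU hU') hid'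
  rw [LinearMap.comp_id, cNorm_κ] at hGD
  have hAQ' : ((ℓ + 1 : ℕ) : ℝ) * (B12₃ + Bx13₀) * Real.exp (δ12₃ * (rNear d ℓ + 1)) * (geo9Y x).L ≤ AQ :=
    (mul_le_mul_of_nonneg_left hLx hK0).trans hAQ
  have hAW'' : 1 * AW * ((w13 s44)⁻¹ * ((((ℓ + 1 : ℕ) : ℝ)) * Real.exp ((δP + σ) * (rNear d ℓ + 1)))) * rowConst261 (@geo9Y d ℓ hd hL b₀ b₁ Mstar) σ ≤ AW' := by
    rw [one_mul]; exact hAW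
  exact ⟨hasMaj_weaken hG (by positivity) hAD (by linarith) hPD, hasMaj_weaken hG (by positivity) hAQ1 (by linarith) hPQ,
    hasMaj_weaken hG (by positivity) hAQ' (by linarith) hPQ2, hasMaj_weaken hG (by positivity) hAW'' le_rfl hGD⟩

end Summit.QuantumFields.YangMills.BalabanUVNodes.N06StateProducersAAtPinsPU

end
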